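import Literature.NumberTheory.EllipticCurves.Pal2012.QuadraticTwistPeriod
import Summits.BirchSwinnertonDyer.Rank1Residual.Additive.RealTwistPeriod
import Summits.BirchSwinnertonDyer.Rank1Residual.Additive.RamifiedTwistMinimality
import Summits.BirchSwinnertonDyer.Rank1Residual.Additive.TwistRamTransport
import HarnessLib

/-!
# Pal 2012 Thm. 3.2 + Prop. 2.5 for the twist by a prime `p ≡ 1 (mod 4)` — DISCHARGED:
# `Pal2012.thm32_sqrt_mul_realPeriodRat_twist_eq_of_prime_one_mod_four` is a THEOREM of the tree
# (cell `b2b-bsdres`, seat additive-p4, gen 11; debt −1)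

HONEST FRAMING (cell `b2b-bsdres`, run/shared/lean/b2b/bsd-rank1-residual/, verbatim in every
file): the goal of the cell is to DELETE the COMBINATION-SHAPED residual classes of the
Birch–Swinnerton-Dyer formula for ALL analytic-rank `≤ 1` elliptic curves over `ℚ` — "full BSD
formula for every rank `≤ 1` curve in class `C`" assembled STRICTLY from published theorems — so
that the rank-`≤ 1` remainder becomes exactly the CONSTRUCTION-SHAPED classes, which are TYPED
(missing-input `Prop`s), NOT attempted. This is not "finishing BSD". The additive sub-cell (seats
additive-p1…p4) is a RESEARCH ROUTE on the construction-shaped classes X3/X4; no claim beyond the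
stated classes; the labels of X3/X4 are UNCHANGED.

Theorems only (no definition, no named fact). The named fact
`Literature.NumberTheory.EllipticCurves.Pal2012.thm32_sqrt_mul_realPeriodRat_twist_eq_of_prime_one_mod_four`
(additive-p4 gen 1, p202706: A. Pal, *Periods of quadratic twists of elliptic curves*, Proc. AMS 140
(2012) 1513–1525, Thm. 3.2 with Prop. 2.5 in the special case `ũ = 1`: for `V`, `W` globally minimal,
`p ≡ 1 (mod 4)` prime, `V` good or multiplicative at `p`, `W ≅ V^{(p)}`: `√p · Ω(W) = Ω(V)`) is PROVED
here from tree theorems, so the cell's debt for it can be retired: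
* `realPeriodRat_mul_sqrt_of_twist_of_pos` (gen 2, `RealTwistPeriod`): `Ω(W) · √d = |u(C)| · Ω(V)` for
  `W = C • V^{(d)}`, `d > 0` (over `ℝ` the twist by `d = (√d)²` is a change of variables);
* `|u(C)| = 1` (`abs_u_eq_one_of_twist_prime_one_mod_four`, this file): a nonzero rational all of
  whose `ℓ`-adic valuations vanish is `±1` (`Rat.abs_eq_one_of_forall_padicValRat_eq_zero`), and
  `ord_ℓ u(C) = 0` at every prime `ℓ` — at `ℓ = p` because both `V^{(p)}` and `W` are `p`-minimal
  (`padicValRat_u_eq_zero_of_twist_pm_p`, gen 2, Pal's Prop. 2.5 local content), at `ℓ ≠ p` because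
  `Δ(W) = u(C)⁻¹² · p⁶ · Δ(V)` (`variableChange_Δ`, `quadraticTwist_Δ`) while the minimal
  discriminants of `V` and `W ≅ V^{(p*)}` have the same `ℓ`-adic valuation, the twist by
  `p* = p ≡ 1 (mod 4)` being unramified at `ℓ` (`padicValInt_minimalDiscriminantInt_eq_of_twist_pStar`,
  gen 3, `TwistRamTransport`; `ℓ = 2` included).
-/

set_option autoImplicit false

noncomputable section

open scoped Classical

open WeierstrassCurve Literature.NumberTheory.EllipticCurves
  Literature.NumberTheory.EllipticCurves.Rank1Residual

namespace Summit.BirchSwinnertonDyer.Rank1Residual.Additive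

/-- A nonzero rational number all of whose `ℓ`-adic valuations vanish is `±1`: its numerator and
denominator are coprime to every prime. -/
theorem Rat.abs_eq_one_of_forall_padicValRat_eq_zero {q : ℚ} (hq : q ≠ 0)
    (h : ∀ ℓ : ℕ, ℓ.Prime → padicValRat ℓ q = 0) : |q| = 1 := by
  -- numerator and denominator have no prime factor
  have hnum : q.num.natAbs = 1 := by
    by_contra hne
    obtain ⟨ℓ, hℓ, hdvd⟩ := Nat.exists_prime_and_dvd hne
    haveI : Fact ℓ.Prime := ⟨hℓ⟩
    have hv := h ℓ hℓ
    rw [padicValRat_def] at hv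
    -- `ℓ ∣ num` and `num`, `den` coprime ⇒ `ℓ ∤ den`
    have hnd : ¬ ℓ ∣ q.den := fun hd =>
      hℓ.one_lt.ne' (Nat.eq_one_of_dvd_one (q.reduced ▸ Nat.dvd_gcd hdvd hd))
    have h1 : padicValNat ℓ q.den = 0 := padicValNat.eq_zero_of_not_dvd hnd
    have h2 : 1 ≤ padicValNat ℓ q.num.natAbs :=
      one_le_padicValNat_of_dvd (Int.natAbs_ne_zero.mpr (Rat.num_ne_zero.mpr hq)) hdvd
    simp only [padicValInt] at hv
    omega
  have hden : q.den = 1 := by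
    by_contra hne
    obtain ⟨ℓ, hℓ, hdvd⟩ := Nat.exists_prime_and_dvd hne
    haveI : Fact ℓ.Prime := ⟨hℓ⟩
    have hv := h ℓ hℓ
    rw [padicValRat_def] at hv
    have hnd : ¬ ℓ ∣ q.num.natAbs := fun hd =>
      hℓ.one_lt.ne' (Nat.eq_one_of_dvd_one (q.reduced ▸ Nat.dvd_gcd hd hdvd))
    have h1 : padicValNat ℓ q.num.natAbs = 0 := padicValNat.eq_zero_of_not_dvd hnd
    have h2 : 1 ≤ padicValNat ℓ q.den := one_le_padicValNat_of_dvd q.den_nz hdvd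
    simp only [padicValInt] at hv
    omega
  have hq' : q = (q.num : ℚ) := by
    conv_lhs => rw [← Rat.num_div_den q, hden]
    simp
  rw [hq', ← Int.cast_abs, Int.abs_eq_natAbs, hnum]
  simp

variable (p : ℕ) [hp : Fact p.Prime]

/-- **`|u(C)| = 1`** for a change of variables `C` over `ℚ` carrying the twist model `V^{(p)}` of a
globally minimal `V`, good or multiplicative at the prime `p ≡ 1 (mod 4)`, to a globally minimal `W`:
every `ℓ`-adic valuation of `u(C)` vanishes — at `ℓ = p` by `padicValRat_u_eq_zero_of_twist_pm_p`
(both equations `p`-minimal; Pal 2012 Prop. 2.5), at `ℓ ≠ p` from `Δ(W) · u¹² = p⁶ · Δ(V)` and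
`v_ℓ(Δ_min W) = v_ℓ(Δ_min V)` (`padicValInt_minimalDiscriminantInt_eq_of_twist_pStar`, the twist by
`p ≡ 1 (mod 4)` being unramified at `ℓ`). -/
theorem abs_u_eq_one_of_twist_prime_one_mod_four (hp4 : p % 4 = 1) (V W : WeierstrassCurve ℚ)
    [V.IsElliptic] [V.IsGloballyMinimal] [W.IsElliptic] [W.IsGloballyMinimal]
    (hV : Good V p ∨ Mult V p) (C : VariableChange ℚ) (hC : C • V.quadraticTwist (p : ℚ) = W) :
    |(C.u : ℚ)| = 1 := by
  have hp2 : p ≠ 2 := by rintro rfl; norm_num at hp4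
  have hu0 : (C.u : ℚ) ≠ 0 := C.u.ne_zero
  have hCz : C • V.quadraticTwist ((p : ℤ) : ℚ) = W := by rwa [Int.cast_natCast]
  refine Rat.abs_eq_one_of_forall_padicValRat_eq_zero hu0 fun ℓ hℓ => ?_
  haveI : Fact ℓ.Prime := ⟨hℓ⟩
  by_cases hℓp : ℓ = p
  · subst hℓp
    exact padicValRat_u_eq_zero_of_twist_pm_p ℓ hp2 V W hV (Or.inl rfl) C hCz
  · -- `ℓ ≠ p`: compare discriminants
    have hdk : (p : ℤ) = 4 * ((p / 4 : ℕ) : ℤ) + 1 := by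
      have := Nat.div_add_mod p 4; rw [hp4] at this; push_cast; omega
    have hmin :=
      padicValInt_minimalDiscriminantInt_eq_of_twist_pStar p V hdk (Or.inl rfl) C hCz hℓp
    -- `Δ(W) · u¹² = p⁶ · Δ(V)` as rationals
    have hΔ : W.Δ * (C.u : ℚ) ^ 12 = (p : ℚ) ^ 6 * V.Δ := by
      rw [← hC, variableChange_Δ, quadraticTwist_Δ, Units.val_inv_eq_inv_val, inv_pow]
      field_simp
    have hVΔ : V.Δ ≠ 0 := by rw [← V.coe_Δ']; exact V.Δ'.ne_zero
    have hWΔ : W.Δ ≠ 0 := by rw [← W.coe_Δ']; exact W.Δ'.ne_zero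
    have hp0 : (p : ℚ) ≠ 0 := by exact_mod_cast hp.out.ne_zero
    have hval := congrArg (padicValRat ℓ) hΔ
    rw [padicValRat.mul hWΔ (pow_ne_zero _ hu0), padicValRat.mul (pow_ne_zero _ hp0) hVΔ,
      padicValRat.pow, padicValRat.pow] at hval
    have hW' : padicValRat ℓ W.Δ = padicValRat ℓ V.Δ := by
      rw [← cast_minimalDiscriminantInt W, ← cast_minimalDiscriminantInt V, padicValRat.of_int,
        padicValRat.of_int, hmin]
    have hpv : padicValRat ℓ (p : ℚ) = 0 := by
      rw [padicValRat.of_nat, padicValNat_primes hℓp, Nat.cast_zero]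
    rw [hW', hpv] at hval
    push_cast at hval
    linarith

/-- **Pal 2012 Thm. 3.2 + Prop. 2.5 (`d = p ≡ 1 (mod 4)`, `ũ = 1`) DISCHARGED**: the named fact
`Pal2012.thm32_sqrt_mul_realPeriodRat_twist_eq_of_prime_one_mod_four` — for globally minimal `V`, `W`
with `W ≅ V^{(p)}`, `p ≡ 1 (mod 4)` prime, `V` good or multiplicative at `p`: `√p · Ω(W) = Ω(V)` —
holds: `Ω(W) · √p = |u(C)| · Ω(V)` (`realPeriodRat_mul_sqrt_of_twist_of_pos`) and `|u(C)| = 1`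
(`abs_u_eq_one_of_twist_prime_one_mod_four`). A. Pal, Proc. AMS 140 (2012), Thm. 3.2, Prop. 2.5. -/
theorem pal2012_thm32_sqrt_mul_realPeriodRat_twist_eq_of_prime_one_mod_four_holds :
    Pal2012.thm32_sqrt_mul_realPeriodRat_twist_eq_of_prime_one_mod_four := by
  intro V W _ _ _ _ p _ hp4 hV hC
  obtain ⟨C, hC⟩ := hC
  have hp0 : (0 : ℚ) < (p : ℚ) := by exact_mod_cast (Fact.out : p.Prime).pos
  have h := realPeriodRat_mul_sqrt_of_twist_of_pos V hp0 W C hC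
  have hu : |((C.u : ℚ) : ℝ)| = 1 := by
    rw [← Rat.cast_abs, abs_u_eq_one_of_twist_prime_one_mod_four p hp4 V W hV C hC, Rat.cast_one]
  rw [hu, one_mul, Rat.cast_natCast] at h
  rw [← h, mul_comm]

end Summit.BirchSwinnertonDyer.Rank1Residual.Additive

end
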